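import Literature.NumberTheory.Automorphic.SymplecticSimilitudeSatakeInjective
import Literature.NumberTheory.Automorphic.SymplecticCartanIwasawaUniqueness
import HarnessLib

/-!
# Bruhat–Tits (4.4.4) (ii) for `GSp_{2n}`: `t(m, a) K₀` is the only coset of `K₀ t(m, a) K₀` with exponents `(m + a, m)`,
# and the Satake transform of `ℋ(GSp_{2n}(K), GSp_{2n}(𝒪); R)` is injective over EVERY commutative ring `R`

[topic NumberTheory/Automorphic] — lane `lit-hodgefound`, seat p11, generation 43, self-proposed theorem-only row g43-#9
(the `GSp_{2n}` counterpart of `SymplecticCartanIwasawaUniqueness` (g43-#6), `CartanIwasawaUniquenessGL` (g42-#1) and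
`HyperspecialUnitaryCartanIwasawaUniqueness` (g43-#3)).

## The print

Bruhat–Tits Prop. (4.4.4) (ii) «On a `K.t.K ∩ B̂⁰.t.K = t.K`»; Cartier §IV, proof of Thm. 4.1 (c) «`c(λ, λ) = δ(λ)^{1/2}`».
For `G = GSp_{2n}(K)` in the tree's conventions (`SymplecticSimilitudeIwasawa`, `SymplecticSimilitudeIwasawaCartan`,
`SymplecticSimilitudeDoubleCosets`): `K₀ = GSp(J, 𝒪)` (entries of `g` and `g⁻¹` integral), `B(K)` upper triangular for the
Borel order `inr 0 < ⋯ < inr (n-1) < inl (n-1) < ⋯ < inl 0`, exponents `(a(g), c(g)) ∈ ℤⁿ × ℤ` (`a(g)ᵢ = ord p_{inl i, inl i}`,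
`c(g) = ord r(p)` for `g = p k`), torus representatives `t(m, a) = diag(ϖ^m ϖ^{a}; ϖ^{-a})` with `a` antitone and
`m + 2aᵢ ≥ 0` (dominant for `B(K)`), `(a, c)(t(m, a)) = (m + a, m)` (Andrianov–Zhuravlev Ch. 3 §3 Lemma 3.6, §3.3; Kottwitz
1992 §7 Lemma 7.4).  (i) is the tree's `sum_similitudeIwasawaExp_head_le` and `snd_similitudeIwasawaExp_eq_of_mem_orbit`; the
tree's injectivity `similitudeSatakeTransform_injective` needed `R` a domain of characteristic `0`.

## What is formalised (kernel path: theorems only, no new definitions, no named facts)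

* §1 `det_submatrix_inr_snoc_of_mem_symplecticSimilitudeBorel` (row-initial minors of a Borel similitude),
  `similitudeTorusElt_mul_neg` (`t(m, a) t(-m, -a) = 1`).
* §2 **(4.4.4) (ii)**: `v_apply_inr_le_of_similitudeIwasawaExp_eq` (entry bound `|p_{inr i, y}| ≤ exp(aᵢ)` through the
  minor bounds `v_minor_le_of_eq_mul_diagonal_mul` / `prod_v_similitudeDiagonal_le`),
  **`coe_eq_coe_similitudeTorusElt_of_similitudeIwasawaExp_eq`** (`gK₀ ⊆ K₀ t(m,a) K₀`, `(a,c)(g) = (m + a, m)` ⟹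
  `gK₀ = t(m,a)K₀`: `w = t(-m,-a) p` has integral `inr`-rows, unit `inr`-diagonal, unit multiplier and determinant
  (`det = rⁿ`), and `inl`-block `r(w) (w₂₂ᵀ)⁻¹` by the block relation `ᵗA D − ᵗC B = r 1` of `transpose_blocks_of_mem`; so `w`
  and `w⁻¹` are integral), `eq_coe_similitudeTorusElt_of_mem_orbit_of_similitudeIwasawaExp_out_eq`,
  `eq_coe_of_mem_orbit_dominantTorusElt` ((UNIQUENESS) in the shape of the abstract criterion).
* §3 **`satakeTransform_similitude_injective_of_commRing`** (`(isIwasawaExponent_similitude hϖ).satakeTransform w` injective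
  for EVERY weight and EVERY commutative ring), **`similitudeSatakeTransform_injective_of_commRing`**,
  `eq_zero_of_satakeTransform_similitude_eq_zero`.
* §4 (Hecke pair) `card_filter_similitudeIwasawaExp_orbit_eq_one`, **`coeff_self_satakeTransform_similitude_torusElt`** (the
  coefficient of `x^{(m+a, m)}` in `𝒮_w(T_{t(m,a)})` is `w(m + a, m)`), `coeff_self_similitudeSatakeTransform_torusElt`
  (`= q^{⟨ρ, m + a⟩}`).

## References
* [cite: BruhatTits1972, Prop. (4.4.4) (i), (ii), p. 80] — F. Bruhat, J. Tits, Groupes réductifs sur un corps local I,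
  Publ. Math. IHÉS 41 (1972), 5–251.
* [cite: CartierCorvallis1979, §IV, Thm. 4.1 and its proof (c)] — P. Cartier, Representations of p-adic groups: a survey,
  Proc. Sympos. Pure Math. 33 (1979), part 1, 111–155.
* [cite: AndrianovZhuravlev1995, Ch. 3 §3 (3.1), Lemma 3.6; §3.3 Thm. 3.30] — A. N. Andrianov, V. G. Zhuravlev, Modular forms
  and Hecke operators, Transl. Math. Monogr. 145, AMS 1995.
* [cite: Kottwitz1992, §7 Lemma 7.4] — R. Kottwitz, Points on some Shimura varieties over finite fields, JAMS 5 (1992).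
* [cite: Macdonald1995, Ch. II §1; Ch. V (2.6)] — I. G. Macdonald, Symmetric functions and Hall polynomials, 2nd ed., 1995.
-/

noncomputable section

open scoped Valued WithZero MatrixGroups
open Matrix MulAction

namespace Literature.NumberTheory.Automorphic.SymplecticCartan

open Literature.NumberTheory.Automorphic.CartanUnique Literature.NumberTheory.Automorphic.HermitianLattice

variable {K : Type*} [Field K] [Valued K ℤᵐ⁰] {ϖ : K} {n : ℕ}

/-! ## §1 Row-initial minors of a Borel similitude; the inverse torus element -/

omit [Valued K ℤᵐ⁰] in
/-- **Row-initial minors of `p ∈ B(K) ≤ GSp_{2n}(K)`**: on the rows `inr 0, …, inr i` and the columns `inr 0, …, inr (i-1), y`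
the minor is `(∏_{l<i} p_{inr l, inr l}) · p_{inr i, y}`. [cite: BruhatTits1972, Prop. (4.4.4)] [cite: Macdonald1995, Ch. II §1] -/
theorem det_submatrix_inr_snoc_of_mem_symplecticSimilitudeBorel {p : symplecticSimilitudeGroup (Fin n) K}
    (hp : p ∈ symplecticSimilitudeBorel n K) (i : Fin n) (y : Fin n ⊕ Fin n) :
    ((((p : GL (Fin n ⊕ Fin n) K)) : Matrix (Fin n ⊕ Fin n) (Fin n ⊕ Fin n) K).submatrix
        (fun l : Fin ((i : ℕ) + 1) => (Sum.inr (⟨l, by omega⟩ : Fin n) : Fin n ⊕ Fin n))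
        (fun l : Fin ((i : ℕ) + 1) => if (l : ℕ) < (i : ℕ) then (Sum.inr (⟨l, by omega⟩ : Fin n) : Fin n ⊕ Fin n) else y)).det =
      (∏ l : Fin (i : ℕ), (((p : GL (Fin n ⊕ Fin n) K)) : Matrix (Fin n ⊕ Fin n) (Fin n ⊕ Fin n) K)
          (Sum.inr ⟨l, by omega⟩) (Sum.inr ⟨l, by omega⟩)) *
        (((p : GL (Fin n ⊕ Fin n) K)) : Matrix (Fin n ⊕ Fin n) (Fin n ⊕ Fin n) K) (Sum.inr i) y := by
  obtain ⟨-, h₂, -⟩ := (blockTriangular_symplecticBorelOrder_iff _).1 (mem_symplecticSimilitudeBorel_iff.1 hp)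
  have htri : ((((p : GL (Fin n ⊕ Fin n) K)) : Matrix (Fin n ⊕ Fin n) (Fin n ⊕ Fin n) K).submatrix
      (fun l : Fin ((i : ℕ) + 1) => (Sum.inr (⟨l, by omega⟩ : Fin n) : Fin n ⊕ Fin n))
      (fun l : Fin ((i : ℕ) + 1) =>
        if (l : ℕ) < (i : ℕ) then (Sum.inr (⟨l, by omega⟩ : Fin n) : Fin n ⊕ Fin n) else y)).BlockTriangular id := by
    intro l l' hll'
    have hlt : (l' : ℕ) < (l : ℕ) := hll'
    have hl' : (l' : ℕ) < (i : ℕ) := by have := l.isLt; omega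
    rw [Matrix.submatrix_apply, if_pos hl']
    exact h₂ _ _ (Fin.lt_def.2 hlt)
  rw [Matrix.det_of_upperTriangular htri, Fin.prod_univ_castSucc]
  congr 1
  · refine Finset.prod_congr rfl fun l _ => ?_
    rw [Matrix.submatrix_apply, if_pos (by rw [Fin.val_castSucc]; exact l.isLt)]
    simp only [Fin.val_castSucc]
  · rw [Matrix.submatrix_apply, if_neg (by rw [Fin.val_last]; exact lt_irrefl _)]
    simp only [Fin.val_last, Fin.eta]

omit [Valued K ℤᵐ⁰] in
/-- `t(m, a) · t(-m, -a) = 1`. [cite: AndrianovZhuravlev1995, Ch. 3 §3 Lemma 3.6] -/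
theorem similitudeTorusElt_mul_neg (hϖ0 : ϖ ≠ 0) (m : ℤ) (a : Fin n → ℤ) :
    (similitudeTorusElt hϖ0 m a : symplecticSimilitudeGroup (Fin n) K) * similitudeTorusElt hϖ0 (-m) (fun i => -a i) = 1 := by
  refine Subtype.ext (Units.ext ?_)
  rw [Subgroup.coe_mul, Units.val_mul, coe_coe_similitudeTorusElt, coe_coe_similitudeTorusElt, Matrix.diagonal_mul_diagonal,
    OneMemClass.coe_one, Units.val_one, ← Matrix.diagonal_one]
  congr 1
  funext x
  rcases x with i | i
  · simp only [Sum.elim_inl]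
    rw [mul_mul_mul_comm, ← zpow_add₀ hϖ0, ← zpow_add₀ hϖ0, add_neg_cancel, add_neg_cancel, zpow_zero, mul_one]
  · simp only [Sum.elim_inr]
    rw [← zpow_add₀ hϖ0, neg_neg, neg_add_cancel, zpow_zero]

/-! ## §2 (4.4.4) (ii): a coset of `K₀ t(m, a) K₀` with exponents `(m + a, m)` is `t(m, a) K₀` -/

variable [NeZero n]

/-- **Entry bound**: if `g = p k ∈ K₀ t(m, a) K₀` (`a` antitone, `m + 2aᵢ ≥ 0`) has exponents `(a, c)(g) = (m + a, m)`, then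
`|p_{inr i, y}| ≤ exp(a_i) = |ϖ^{-a_i}|` for every column `y`. [cite: BruhatTits1972, Prop. (4.4.4) (ii)]
[cite: Macdonald1995, Ch. II §1, Ch. V (2.6)] -/
theorem v_apply_inr_le_of_similitudeIwasawaExp_eq (hϖ : Valued.v ϖ = WithZero.exp (-1 : ℤ)) {m : ℤ} {a : Fin n → ℤ}
    (ha : Antitone a) (hm : ∀ i, 0 ≤ m + 2 * a i) {g p k : symplecticSimilitudeGroup (Fin n) K}
    (hp : p ∈ symplecticSimilitudeBorel n K) (hk : k ∈ symplecticSimilitudeInt (Fin n) K) (hpk : g = p * k)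
    (hg : (g : symplecticSimilitudeGroup (Fin n) K ⧸ symplecticSimilitudeInt (Fin n) K) ∈
      MulAction.orbit (symplecticSimilitudeInt (Fin n) K)
        ((similitudeTorusElt (uniformizer_ne_zero hϖ) m a : symplecticSimilitudeGroup (Fin n) K) :
          symplecticSimilitudeGroup (Fin n) K ⧸ symplecticSimilitudeInt (Fin n) K))
    (he : similitudeIwasawaExp hϖ g = (fun i => m + a i, m)) (i : Fin n) (y : Fin n ⊕ Fin n) :
    Valued.v ((((p : GL (Fin n ⊕ Fin n) K)) : Matrix (Fin n ⊕ Fin n) (Fin n ⊕ Fin n) K) (Sum.inr i) y) ≤ WithZero.exp (a i) := by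
  obtain ⟨A, hA, B, hB, hgAB⟩ := (heckeAlgebra.coe_mem_orbit_coe_iff (symplecticSimilitudeInt (Fin n) K) _ _).1 hg
  have hmat : (((p : GL (Fin n ⊕ Fin n) K)) : Matrix (Fin n ⊕ Fin n) (Fin n ⊕ Fin n) K) =
      (((A : GL (Fin n ⊕ Fin n) K)) : Matrix (Fin n ⊕ Fin n) (Fin n ⊕ Fin n) K) *
        Matrix.diagonal (Sum.elim (fun i => ϖ ^ m * ϖ ^ a i) (fun i => ϖ ^ (-a i))) *
        (((B : GL (Fin n ⊕ Fin n) K)) : Matrix (Fin n ⊕ Fin n) (Fin n ⊕ Fin n) K) *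
        ((((k : GL (Fin n ⊕ Fin n) K))⁻¹ : GL (Fin n ⊕ Fin n) K) : Matrix (Fin n ⊕ Fin n) (Fin n ⊕ Fin n) K) := by
    have hpk' : p = g * k⁻¹ := by rw [hpk, mul_inv_cancel_right]
    rw [hpk', hgAB, Subgroup.coe_mul, Subgroup.coe_inv, Subgroup.coe_mul, Subgroup.coe_mul, Units.val_mul, Units.val_mul,
      Units.val_mul, coe_coe_similitudeTorusElt]
  have hmin := v_minor_le_of_eq_mul_diagonal_mul (prod_v_similitudeDiagonal_le hϖ ha hm (Nat.succ_le_of_lt i.isLt))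
    (mem_symplecticSimilitudeInt_iff.1 hA).1 (mem_symplecticSimilitudeInt_iff.1 hB).1 (mem_symplecticSimilitudeInt_iff.1 hk).2
    hmat (fun l : Fin ((i : ℕ) + 1) => (Sum.inr (⟨l, by omega⟩ : Fin n) : Fin n ⊕ Fin n))
    (fun l : Fin ((i : ℕ) + 1) => if (l : ℕ) < (i : ℕ) then (Sum.inr (⟨l, by omega⟩ : Fin n) : Fin n ⊕ Fin n) else y)
  rw [det_submatrix_inr_snoc_of_mem_symplecticSimilitudeBorel hp i y, map_mul, map_prod] at hmin
  simp_rw [v_apply_inr_eq_exp_sub hϖ hp hk hpk, he, add_sub_cancel_left] at hmin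
  have hprod : ∏ l : Fin (i : ℕ), WithZero.exp (a ⟨l, by omega⟩) = WithZero.exp (∑ l : Fin (i : ℕ), a ⟨l, by omega⟩) := by
    have h := prod_exp_neg_eq Finset.univ (fun l : Fin (i : ℕ) => -a ⟨l, by omega⟩)
    simpa only [neg_neg, Finset.sum_neg_distrib] using h
  have hsplit : (∑ j : Fin n, if (j : ℕ) < (i : ℕ) + 1 then a j else 0) = (∑ l : Fin (i : ℕ), a ⟨l, by omega⟩) + a i := by
    rw [sum_ite_lt_succ_eq a i, sum_first_eq_sum_ite i.isLt.le a]
  rw [hprod, hsplit, WithZero.exp_add] at hmin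
  have h := mul_le_mul_right hmin (WithZero.exp (-(∑ l : Fin (i : ℕ), a ⟨l, by omega⟩)))
  rwa [← mul_assoc, ← mul_assoc, ← WithZero.exp_add, neg_add_cancel, WithZero.exp_zero, one_mul, one_mul] at h

/-- **BRUHAT–TITS (4.4.4) (ii) FOR `GSp_{2n}`**: a coset `gK₀ ⊆ K₀ t(m, a) K₀` (`a` antitone, `m + 2aᵢ ≥ 0`) whose Iwasawa
exponents are `(a, c)(g) = (m + a, m) = (a, c)(t(m, a))` IS the coset `t(m, a) K₀`.  Proof: `w = t(m, a)⁻¹ p` (`g = p k`) has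
integral `inr`-rows (entry bound), unit `inr`-diagonal, unit multiplier, `inl`-block `= r(w) (w₂₂ᵀ)⁻¹` integral (the block
relation `ᵗA D − ᵗC B = r(w) 1` with `B = 0`), and `det w = r(w)ⁿ` a unit, so `w, w⁻¹` are integral: `w ∈ K₀`.
[cite: BruhatTits1972, Prop. (4.4.4) (ii)] [cite: CartierCorvallis1979, §IV, proof of Thm. 4.1 (c)]
[cite: AndrianovZhuravlev1995, Ch. 3 §3 (3.1), Lemma 3.6] -/
theorem coe_eq_coe_similitudeTorusElt_of_similitudeIwasawaExp_eq (hϖ : Valued.v ϖ = WithZero.exp (-1 : ℤ)) {m : ℤ}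
    {a : Fin n → ℤ} (ha : Antitone a) (hm : ∀ i, 0 ≤ m + 2 * a i) {g : symplecticSimilitudeGroup (Fin n) K}
    (hg : (g : symplecticSimilitudeGroup (Fin n) K ⧸ symplecticSimilitudeInt (Fin n) K) ∈
      MulAction.orbit (symplecticSimilitudeInt (Fin n) K)
        ((similitudeTorusElt (uniformizer_ne_zero hϖ) m a : symplecticSimilitudeGroup (Fin n) K) :
          symplecticSimilitudeGroup (Fin n) K ⧸ symplecticSimilitudeInt (Fin n) K))
    (he : similitudeIwasawaExp hϖ g = (fun i => m + a i, m)) :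
    (g : symplecticSimilitudeGroup (Fin n) K ⧸ symplecticSimilitudeInt (Fin n) K) =
      ((similitudeTorusElt (uniformizer_ne_zero hϖ) m a : symplecticSimilitudeGroup (Fin n) K) :
          symplecticSimilitudeGroup (Fin n) K ⧸ symplecticSimilitudeInt (Fin n) K) := by
  haveI : Nonempty (Fin n) := ⟨⟨0, Nat.pos_of_ne_zero (NeZero.ne n)⟩⟩
  have hϖ0 := CartanUnique.uniformizer_ne_zero hϖ
  obtain ⟨p, k, hp, hk, hpk⟩ := exists_mem_symplecticSimilitudeBorel_mul_symplecticSimilitudeInt hϖ g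
  -- the candidate `w = t(-m, -a) p = t(m, a)⁻¹ p`
  set w : symplecticSimilitudeGroup (Fin n) K := similitudeTorusElt hϖ0 (-m) (fun i => -a i) * p with hw
  have hDw : (similitudeTorusElt hϖ0 m a : symplecticSimilitudeGroup (Fin n) K) * w = p := by
    rw [hw, ← mul_assoc, similitudeTorusElt_mul_neg, one_mul]
  have hwB : w ∈ symplecticSimilitudeBorel n K :=
    (symplecticSimilitudeBorel n K).mul_mem (similitudeTorusElt_mem_symplecticSimilitudeBorel hϖ0 _ _) hp
  obtain ⟨hw₁, hw₂, -⟩ := (blockTriangular_symplecticBorelOrder_iff _).1 (mem_symplecticSimilitudeBorel_iff.1 hwB)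
  have hwapply : ∀ x y, (((w : GL (Fin n ⊕ Fin n) K)) : Matrix (Fin n ⊕ Fin n) (Fin n ⊕ Fin n) K) x y =
      Sum.elim (fun i => ϖ ^ (-m) * ϖ ^ (-a i)) (fun i => ϖ ^ (-(-a i))) x *
        (((p : GL (Fin n ⊕ Fin n) K)) : Matrix (Fin n ⊕ Fin n) (Fin n ⊕ Fin n) K) x y := fun x y => by
    rw [hw, Subgroup.coe_mul, Units.val_mul, coe_coe_similitudeTorusElt, Matrix.diagonal_mul]
  -- (1) integral `inr`-rows
  have hinr : ∀ i y, Valued.v ((((w : GL (Fin n ⊕ Fin n) K)) : Matrix (Fin n ⊕ Fin n) (Fin n ⊕ Fin n) K) (Sum.inr i) y) ≤ 1 :=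
    fun i y => by
      rw [hwapply, Sum.elim_inr, neg_neg, map_mul, v_uniformizer_zpow hϖ]
      calc WithZero.exp (-a i) * Valued.v ((((p : GL (Fin n ⊕ Fin n) K)) : Matrix (Fin n ⊕ Fin n) (Fin n ⊕ Fin n) K) (Sum.inr i) y)
          ≤ WithZero.exp (-a i) * WithZero.exp (a i) :=
            mul_le_mul_right (v_apply_inr_le_of_similitudeIwasawaExp_eq hϖ ha hm hp hk hpk hg he i y) _
        _ = 1 := by rw [← WithZero.exp_add, neg_add_cancel, WithZero.exp_zero]
  -- (2) unit `inr`-diagonal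
  have hdiag : ∀ i, Valued.v ((((w : GL (Fin n ⊕ Fin n) K)) : Matrix (Fin n ⊕ Fin n) (Fin n ⊕ Fin n) K)
      (Sum.inr i) (Sum.inr i)) = 1 := fun i => by
    rw [hwapply, Sum.elim_inr, neg_neg, map_mul, v_uniformizer_zpow hϖ, v_apply_inr_eq_exp_sub hϖ hp hk hpk i, he,
      add_sub_cancel_left, ← WithZero.exp_add, neg_add_cancel, WithZero.exp_zero]
  -- (3) unit multiplier and unit determinant
  have hmult : Valued.v (multiplier w : K) = 1 := by
    rw [hw, multiplier_mul, Units.val_mul, map_mul, multiplier_similitudeTorusElt, v_uniformizer_zpow hϖ,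
      v_multiplier_eq_exp_neg_snd hϖ hk hpk, he, ← WithZero.exp_add, neg_neg, add_neg_cancel, WithZero.exp_zero]
  have hdet : Valued.v ((((w : GL (Fin n ⊕ Fin n) K)) : Matrix (Fin n ⊕ Fin n) (Fin n ⊕ Fin n) K)).det = 1 := by
    rw [det_coe_eq_multiplier_pow, map_pow, hmult, one_pow]
  -- (4) the `inl`-block: `ᵗD A = r(w) 1` with `D = w₂₂` of unit determinant, so `A = r(w) (ᵗD)⁻¹` is integral
  set M := (((w : GL (Fin n ⊕ Fin n) K)) : Matrix (Fin n ⊕ Fin n) (Fin n ⊕ Fin n) K) with hM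
  have hB : M.toBlocks₁₂ = 0 := by
    ext i j
    exact hw₁ i j
  obtain ⟨-, -, hAD⟩ := transpose_blocks_of_mem (g := w) (A := M.toBlocks₁₁) (B := M.toBlocks₁₂) (C := M.toBlocks₂₁)
    (D := M.toBlocks₂₂) (Matrix.fromBlocks_toBlocks M).symm
  rw [hB, Matrix.mul_zero, sub_zero] at hAD
  have hDA : M.toBlocks₂₂ᵀ * M.toBlocks₁₁ = (multiplier w : K) • (1 : Matrix (Fin n) (Fin n) K) := by
    have h := congrArg Matrix.transpose hAD
    rwa [Matrix.transpose_mul, Matrix.transpose_transpose, Matrix.transpose_smul, Matrix.transpose_one] at h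
  have hU1 : ∀ i j, Valued.v (M.toBlocks₂₂ᵀ i j) ≤ 1 := fun i j => by
    rw [Matrix.transpose_apply]
    exact hinr j (Sum.inr i)
  have hUtri : (M.toBlocks₂₂).BlockTriangular id := fun i j hij => hw₂ i j hij
  have hUdet : Valued.v (M.toBlocks₂₂ᵀ).det = 1 := by
    rw [Matrix.det_transpose, Matrix.det_of_upperTriangular hUtri, map_prod]
    exact Finset.prod_eq_one fun i _ => hdiag i
  have hUunit : IsUnit (M.toBlocks₂₂ᵀ).det := isUnit_iff_ne_zero.2 fun h => by
    rw [h, map_zero] at hUdet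
    exact zero_ne_one hUdet
  have hA : M.toBlocks₁₁ = (multiplier w : K) • (M.toBlocks₂₂ᵀ)⁻¹ := by
    calc M.toBlocks₁₁ = (M.toBlocks₂₂ᵀ)⁻¹ * (M.toBlocks₂₂ᵀ * M.toBlocks₁₁) := by
          rw [← Matrix.mul_assoc, Matrix.nonsing_inv_mul _ hUunit, Matrix.one_mul]
      _ = (multiplier w : K) • (M.toBlocks₂₂ᵀ)⁻¹ := by rw [hDA, Matrix.mul_smul, Matrix.mul_one]
  have hL : ∀ i j, Valued.v (M (Sum.inl i) (Sum.inl j)) ≤ 1 := fun i j => by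
    have h : M (Sum.inl i) (Sum.inl j) = M.toBlocks₁₁ i j := rfl
    rw [h, hA, Matrix.smul_apply, smul_eq_mul, map_mul, hmult, one_mul]
    exact v_inv_apply_le_one_of_v_det_eq_one hU1 hUdet i j
  -- (5) `w ∈ K₀`
  have hint : ∀ x y, Valued.v (M x y) ≤ 1 := by
    rintro (i | i) y
    · rcases y with j | j
      · exact hL i j
      · rw [hw₁ i j, map_zero]
        exact zero_le
    · exact hinr i y
  have hwK : w ∈ symplecticSimilitudeInt (Fin n) K := by
    refine mem_symplecticSimilitudeInt_iff.2 ⟨hint, fun i j => ?_⟩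
    rw [Matrix.coe_units_inv]
    exact v_inv_apply_le_one_of_v_det_eq_one hint hdet i j
  -- (6) `gK₀ = pK₀ = t(m, a) w K₀ = t(m, a) K₀`
  rw [hpk, QuotientGroup.mk_mul_of_mem p hk, ← hDw, QuotientGroup.mk_mul_of_mem _ hwK]

/-- (4.4.4) (ii) on cosets: `γ ⊆ K₀ t(m, a) K₀` with `(a, c)(γ) = (m + a, m)` is `γ = t(m, a) K₀`.
[cite: BruhatTits1972, Prop. (4.4.4) (ii)] -/
theorem eq_coe_similitudeTorusElt_of_mem_orbit_of_similitudeIwasawaExp_out_eq (hϖ : Valued.v ϖ = WithZero.exp (-1 : ℤ))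
    {m : ℤ} {a : Fin n → ℤ} (ha : Antitone a) (hm : ∀ i, 0 ≤ m + 2 * a i)
    {γ : symplecticSimilitudeGroup (Fin n) K ⧸ symplecticSimilitudeInt (Fin n) K}
    (hγ : γ ∈ MulAction.orbit (symplecticSimilitudeInt (Fin n) K)
      ((similitudeTorusElt (uniformizer_ne_zero hϖ) m a : symplecticSimilitudeGroup (Fin n) K) :
          symplecticSimilitudeGroup (Fin n) K ⧸ symplecticSimilitudeInt (Fin n) K))
    (he : similitudeIwasawaExp hϖ γ.out = (fun i => m + a i, m)) :
    γ = ((similitudeTorusElt (uniformizer_ne_zero hϖ) m a : symplecticSimilitudeGroup (Fin n) K) :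
          symplecticSimilitudeGroup (Fin n) K ⧸ symplecticSimilitudeInt (Fin n) K) := by
  rw [← QuotientGroup.out_eq' γ] at hγ ⊢
  exact coe_eq_coe_similitudeTorusElt_of_similitudeIwasawaExp_eq hϖ ha hm hγ he

/-- **(UNIQUENESS)** in the shape of the abstract criterion of `CartanIwasawaUniquenessGL` §3, on the dominant torus
representatives `{t(m, a) : a antitone, m + 2aᵢ ≥ 0}`. [cite: BruhatTits1972, Prop. (4.4.4) (ii)] -/
theorem eq_coe_of_mem_orbit_dominantTorusElt (hϖ : Valued.v ϖ = WithZero.exp (-1 : ℤ)) :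
    ∀ t ∈ {t : symplecticSimilitudeGroup (Fin n) K | ∃ (m : ℤ) (a : Fin n → ℤ), Antitone a ∧ (∀ i, 0 ≤ m + 2 * a i) ∧
        t = similitudeTorusElt (uniformizer_ne_zero hϖ) m a},
      ∀ γ ∈ MulAction.orbit (symplecticSimilitudeInt (Fin n) K)
          (t : symplecticSimilitudeGroup (Fin n) K ⧸ symplecticSimilitudeInt (Fin n) K),
        similitudeIwasawaExp hϖ γ.out = similitudeIwasawaExp hϖ t →
          γ = (t : symplecticSimilitudeGroup (Fin n) K ⧸ symplecticSimilitudeInt (Fin n) K) := by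
  rintro _ ⟨m, a, ha, hm, rfl⟩ γ hγ he
  rw [similitudeIwasawaExp_similitudeTorusElt] at he
  exact eq_coe_similitudeTorusElt_of_mem_orbit_of_similitudeIwasawaExp_out_eq hϖ ha hm hγ he

/-! ## §3 Injectivity of the similitude Satake transform over every commutative ring -/

variable {R : Type*} [CommRing R]

/-- **THE SATAKE TRANSFORM OF `ℋ(GSp_{2n}(K), GSp_{2n}(𝒪); R)` IS INJECTIVE FOR EVERY COMMUTATIVE RING `R` AND EVERY WEIGHT**
(the tree's `similitudeSatakeTransform_injective` needed a domain of characteristic `0`).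
[cite: CartierCorvallis1979, §IV Thm. 4.1 (injectivity half)] [cite: BruhatTits1972, Prop. (4.4.4) (i), (ii)]
[cite: AndrianovZhuravlev1995, Ch. 3 §3.3 Thm. 3.30] -/
theorem satakeTransform_similitude_injective_of_commRing (hϖ : Valued.v ϖ = WithZero.exp (-1 : ℤ))
    (w : Multiplicative ((Fin n → ℤ) × ℤ) →* R) :
    Function.Injective ((isIwasawaExponent_similitude (n := n) hϖ).satakeTransform w) :=
  (isIwasawaExponent_similitude hϖ).satakeTransform_injective_of_unique w
    (φ := fun ac : (Fin n → ℤ) × ℤ => toLex (fun r : Fin n => ∑ i : Fin n, if (i : ℕ) < (r : ℕ) + 1 then ac.1 i else 0))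
    (exists_dominantTorusElt_mem_orbit hϖ) (injOn_similitudeIwasawaExp_dominantTorusElt hϖ)
    (similitudeIwasawaExp_eq_or_headSum_lt hϖ) (eq_coe_of_mem_orbit_dominantTorusElt hϖ)

/-- **`similitudeSatakeTransform hϖ q` is injective over every commutative ring `R`**, every `q ∈ Rˣ`.
[cite: CartierCorvallis1979, §IV Thm. 4.1 (injectivity half)] [cite: BruhatTits1972, Prop. (4.4.4) (ii)] -/
theorem similitudeSatakeTransform_injective_of_commRing (hϖ : Valued.v ϖ = WithZero.exp (-1 : ℤ)) (q : Rˣ) :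
    Function.Injective (similitudeSatakeTransform (n := n) (R := R) hϖ q) :=
  satakeTransform_similitude_injective_of_commRing hϖ (similitudeSatakeWeight q)

/-- Injectivity as a kernel statement: `𝒮_w(T) = 0 ⇒ T = 0`, any commutative `R`.
[cite: CartierCorvallis1979, §IV Thm. 4.1 (injectivity half)] -/
theorem eq_zero_of_satakeTransform_similitude_eq_zero (hϖ : Valued.v ϖ = WithZero.exp (-1 : ℤ))
    (w : Multiplicative ((Fin n → ℤ) × ℤ) →* R)
    {T : heckeAlgebra R (symplecticSimilitudeGroup (Fin n) K) (symplecticSimilitudeInt (Fin n) K)}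
    (hT : (isIwasawaExponent_similitude (n := n) hϖ).satakeTransform w T = 0) : T = 0 :=
  satakeTransform_similitude_injective_of_commRing hϖ w (by rw [hT, map_zero])

/-! ## §4 The top coefficient of `𝒮_w(T_{t(m,a)})` is the unit `w(m + a, m)` -/

variable [IsHeckeTriple (⊤ : Submonoid (symplecticSimilitudeGroup (Fin n) K)) (symplecticSimilitudeInt (Fin n) K)
  (symplecticSimilitudeInt (Fin n) K)]

/-- **Exactly one coset of `K₀ t(m, a) K₀` has exponents `(m + a, m)`** (`a` antitone, `m + 2aᵢ ≥ 0`).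
[cite: BruhatTits1972, Prop. (4.4.4) (ii)] -/
theorem card_filter_similitudeIwasawaExp_orbit_eq_one (hϖ : Valued.v ϖ = WithZero.exp (-1 : ℤ)) {m : ℤ} {a : Fin n → ℤ}
    (ha : Antitone a) (hm : ∀ i, 0 ≤ m + 2 * a i)
    [DecidablePred fun γ : symplecticSimilitudeGroup (Fin n) K ⧸ symplecticSimilitudeInt (Fin n) K =>
      similitudeIwasawaExp hϖ γ.out = (fun i => m + a i, m)] :
    ((finite_orbit_quotient (symplecticSimilitudeInt (Fin n) K)
        (similitudeTorusElt (uniformizer_ne_zero hϖ) m a : symplecticSimilitudeGroup (Fin n) K)).toFinset.filter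
        fun γ => similitudeIwasawaExp hϖ γ.out = (fun i => m + a i, m)).card = 1 := by
  rw [Finset.card_eq_one]
  refine ⟨((similitudeTorusElt (uniformizer_ne_zero hϖ) m a : symplecticSimilitudeGroup (Fin n) K) :
      symplecticSimilitudeGroup (Fin n) K ⧸ symplecticSimilitudeInt (Fin n) K), ?_⟩
  ext γ
  rw [Finset.mem_filter, Set.Finite.mem_toFinset, Finset.mem_singleton]
  constructor
  · rintro ⟨hγ, he⟩
    exact eq_coe_similitudeTorusElt_of_mem_orbit_of_similitudeIwasawaExp_out_eq hϖ ha hm hγ he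
  · rintro rfl
    refine ⟨MulAction.mem_orbit_self _, ?_⟩
    rw [(isIwasawaExponent_similitude hϖ).apply_out_coe, similitudeIwasawaExp_similitudeTorusElt]

/-- **The top coefficient of `𝒮_w(T_{t(m,a)})` is the unit `w(m + a, m)`** (`a` antitone, `m + 2aᵢ ≥ 0`; any weight `w`,
any commutative ring) — Cartier's «`c(λ, λ) = δ(λ)^{1/2}`», sharpening the tree's
`coeff_self_similitudeSatakeTransform_torusElt_ne_zero` (`≠ 0` over domains of characteristic `0`).
[cite: CartierCorvallis1979, §IV, proof of Thm. 4.1 (c)] [cite: BruhatTits1972, Prop. (4.4.4) (ii)] -/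
theorem coeff_self_satakeTransform_similitude_torusElt (hϖ : Valued.v ϖ = WithZero.exp (-1 : ℤ))
    (w : Multiplicative ((Fin n → ℤ) × ℤ) →* R) {m : ℤ} {a : Fin n → ℤ} (ha : Antitone a) (hm : ∀ i, 0 ≤ m + 2 * a i) :
    ((isIwasawaExponent_similitude (n := n) hϖ).satakeTransform w
        (heckeAlgebra.doubleCosetOperator (symplecticSimilitudeInt (Fin n) K)
          (similitudeTorusElt (uniformizer_ne_zero hϖ) m a : symplecticSimilitudeGroup (Fin n) K))).coeff
        (fun i => m + a i, m) = w (Multiplicative.ofAdd (fun i => m + a i, m)) := by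
  rw [← similitudeIwasawaExp_similitudeTorusElt hϖ m a]
  exact (isIwasawaExponent_similitude hϖ).coeff_self_satakeTransform_doubleCosetOperator_of_unique w
    (eq_coe_of_mem_orbit_dominantTorusElt hϖ _ ⟨m, a, ha, hm, rfl⟩)

/-- **The top coefficient of `similitudeSatakeTransform hϖ q (T_{t(m,a)})` is `q^{⟨ρ, m + a⟩}`**.
[cite: CartierCorvallis1979, §IV (4.2), proof of Thm. 4.1 (c)] [cite: AndrianovZhuravlev1995, Ch. 3 §3.3 (3.46)–(3.49)] -/
theorem coeff_self_similitudeSatakeTransform_torusElt (hϖ : Valued.v ϖ = WithZero.exp (-1 : ℤ)) (q : Rˣ) {m : ℤ}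
    {a : Fin n → ℤ} (ha : Antitone a) (hm : ∀ i, 0 ≤ m + 2 * a i) :
    (similitudeSatakeTransform hϖ q (heckeAlgebra.doubleCosetOperator (symplecticSimilitudeInt (Fin n) K)
      (similitudeTorusElt (uniformizer_ne_zero hϖ) m a : symplecticSimilitudeGroup (Fin n) K))).coeff (fun i => m + a i, m) =
      ((q ^ symplecticRhoPairing (fun i => m + a i) : Rˣ) : R) := by
  rw [similitudeSatakeTransform_eq, coeff_self_satakeTransform_similitude_torusElt hϖ _ ha hm, similitudeSatakeWeight_ofAdd]

end Literature.NumberTheory.Automorphic.SymplecticCartan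

end
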